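import Summits.ResolutionOfSingularities.ResolutionOfSingularities.Theorems.HomologicalConductorNoZenoRNoetherDifferentTorsionFree
import Summits.ResolutionOfSingularities.ResolutionOfSingularities.Theorems.HomologicalConductorNoZenoReflexiveHull
import Literature.RingTheory.CohomologyAnnihilator.JacobianFloorKaehlerDifferent
import Literature.RingTheory.CohomologyAnnihilator.KaehlerDifferent
import Literature.RingTheory.CohomologyAnnihilator.RegularLocalRing
import Literature.RingTheory.CohomologyAnnihilator.RegularRing
import Literature.RingTheory.CohomologyAnnihilator.Localization
import Literature.AlgebraicGeometry.Resolution.AffineDomainDimension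
import Mathlib.RingTheory.IntegralClosure.IntegrallyClosed
import Mathlib.LinearAlgebra.Dual.Lemmas
import HarnessLib

/-!
# Crux `NoZenoR` (stmt-ResolutionOfSingularities-19943): the W3 print `jacobianFloorNN_normal_dim3`
# (Iyengar–Takahashi 2016, Thm 3.8 for normal threefolds) is a THEOREM

Route `ResolutionOfSingularities/HomologicalConductor` (cell decomp-res, hand leafhand-res-homologicalconduct-16 g1).
OURS: AI-written, weaker than expert review; nothing here is a statement of the manuscript under review
(Hironaka 2017).  SUPPORT level, counted 0.  Def-free; no new named facts.

The registered stub `stub_publishedSurfaceFactsW3` of crux `NoZenoR` is equivalent to a bundle of nine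
printed facts (`…FactsW3Nine.factsW3_iff_nine`), one of which is
`Literature.RingTheory.CohomologyAnnihilator.jacobianFloorNN_normal_dim3` (Iyengar–Takahashi 2016, Thm 3.8,
one Kähler-different summand, normal domains of dimension `3`: `Fitt₀(Ω[B⁄A]) ≤ ca⁴(B)` for every Noether
normalisation `A → B`).  The printed proof uses the DERIVED noether different because a normal threefold
need not be Cohen–Macaulay (the tree had only the projective = Cohen–Macaulay case,
`…KaehlerDifferentFloor`).  Here the fact is PROVED in full:

* `isReflexive_of_isIntegrallyClosed` — a NORMAL domain `B`, module-finite over a noetherian domain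
  `A ⊆ B`, is a reflexive `A`-module: the reflexive hull of `B` inside `Frac B` (tree
  `SandwichCluster.reflexiveHull`, `≅ B**`) is closed under multiplication, hence a module-finite
  `B`-algebra, hence `= B` by normality;
* `hasProjectiveDimensionLT_of_isReflexive` — over a noetherian `A` with `caⁿ⁺³(A) = A`, finite
  reflexive modules have projective dimension `≤ n` (`M ≅ M**` is the kernel of the dual of a finite
  presentation: two dimension shifts);
* `jacobianFloorNN_normal_dim3_holds : jacobianFloorNN_normal_dim3` — `A` is regular (`caⁿ(A) = A`
  localises; tree Lemma 2.10 + Serre) of dimension `3`, so `ca⁴(A) = A`; `B` is reflexive, so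
  `pd_A B ≤ 1`; then `Fitt₀(Ω[B⁄A]) ≤ 𝔑(B/A)` (tree, Scheja–Storch) `≤ ca⁴(B)`
  (`NoetherDifferentTorsionFree.noetherDifferent_le_cohomologyAnnihilatorOfDegree_of_hasProjectiveDimensionLT_two`).

Hence the nine-print residual of `stub_publishedSurfaceFactsW3` drops to EIGHT (sibling `…FactsW3Eight`).
-/

noncomputable section

-- single-problem summit: the doubled namespace component `ResolutionOfSingularities` is forced
set_option linter.dupNamespace false

open CategoryTheory CategoryTheory.Abelian Module
open Literature.RingTheory.CohomologyAnnihilator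
open Summit.ResolutionOfSingularities.ResolutionOfSingularities.Theorems.NoZeno.SandwichCluster

universe u

namespace Summit.ResolutionOfSingularities.ResolutionOfSingularities.Theorems.NoZeno.JacobianFloorNormal

/-! ## §1 Normal finite extensions are reflexive -/

section Reflexive

variable {A : Type u} [CommRing A] [IsDomain A] [IsNoetherianRing A]
variable {B : Type u} [CommRing B] [IsDomain B] [Algebra A B] [Module.Finite A B] [FaithfulSMul A B]
  [IsIntegrallyClosed B]

/-- **A normal domain, module-finite over a noetherian domain `A ⊆ B`, is a reflexive `A`-module.**
Inside `L = Frac B` the reflexive hull `B×× ⊇ B` of the lattice `B` (`≅ B**`, tree `reflexiveHull`) is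
stable under multiplication by `B` (precompose functionals with `b·`) and under products of its own
elements (for `w ∈ B××` the functional `n ↦ φ_K(w n)` is again integral-valued), hence a `B`-subalgebra
of `L` which is finitely generated as an `A`-module; its elements are therefore integral over `B`, so
lie in `B`.  [this work; cf. BrunsHerzog1998 Prop. 1.4.1] -/
theorem isReflexive_of_isIntegrallyClosed : Module.IsReflexive A B := by
  let L := FractionRing B
  haveI : NoZeroSMulDivisors A L := ⟨fun {a x} h => by
    rw [Algebra.smul_def, mul_eq_zero] at h
    exact h.imp_left fun ha => FaithfulSMul.algebraMap_injective A L (by rw [ha, map_zero])⟩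
  -- `B` as a finitely generated `A`-submodule `N` of `L`
  let toL : B →ₗ[A] L := (IsScalarTower.toAlgHom A B L).toLinearMap
  have htoL : ∀ b, toL b = algebraMap B L b := fun _ => rfl
  have hinj : Function.Injective toL := IsFractionRing.injective B L
  let N : Submodule A L := LinearMap.range toL
  have hN : ∀ {w : L}, w ∈ N ↔ ∃ b : B, algebraMap B L b = w := fun {w} => LinearMap.mem_range
  -- (a) `B · hull ⊆ hull`
  have hmulB : ∀ (b : B) {w : L}, w ∈ reflexiveHull N → algebraMap B L b * w ∈ reflexiveHull N := by
    intro b w hw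
    obtain ⟨s, hs, ⟨n, hn⟩, -⟩ := id hw
    let mb : N →ₗ[A] N := (LinearMap.mulLeft A (algebraMap B L b)).restrict fun x hx => by
      obtain ⟨c, rfl⟩ := hN.mp hx
      exact hN.mpr ⟨b * c, by rw [map_mul]; rfl⟩
    have hmb : ((mb n : N) : L) = s • (algebraMap B L b * w) := by
      change algebraMap B L b * (n : L) = _
      rw [hn, mul_smul_comm]
    exact (mem_reflexiveHull_iff_forall_dvd N hs (mb n) hmb).mpr fun φ =>
      dvd_apply_of_mem_reflexiveHull N hw hn (φ ∘ₗ mb)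
  -- (b) `hull · hull ⊆ hull`
  have hmul : ∀ {w w' : L}, w ∈ reflexiveHull N → w' ∈ reflexiveHull N →
      w * w' ∈ reflexiveHull N := by
    intro w w' hw hw'
    obtain ⟨s, hs, ⟨n, hn⟩, -⟩ := id hw
    obtain ⟨s', hs', ⟨n', hn'⟩, -⟩ := id hw'
    obtain ⟨b, hb⟩ := hN.mp n.2
    obtain ⟨b', hb'⟩ := hN.mp n'.2
    -- the multiple `(s s') • (w w') = n n' ∈ N`
    let nn : N := ⟨algebraMap B L (b * b'), hN.mpr ⟨b * b', rfl⟩⟩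
    have hnn : ((nn : N) : L) = (s * s') • (w * w') := by
      change algebraMap B L (b * b') = _
      rw [map_mul, hb, hb', hn, hn', smul_mul_smul_comm]
    refine (mem_reflexiveHull_iff_forall_dvd N (mul_ne_zero hs hs') nn hnn).mpr fun φ => ?_
    -- the functional `ψ = (m ↦ φ_K(w m))` on `N`
    let mw : N →ₗ[A] reflexiveHull N :=
      { toFun := fun m => ⟨w * (m : L), by
          obtain ⟨c, hc⟩ := hN.mp m.2
          rw [← hc, mul_comm]
          exact hmulB c hw⟩
        map_add' := fun m m' => Subtype.ext (by simp [mul_add])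
        map_smul' := fun a m => Subtype.ext (by simp) }
    let ψ : Module.Dual A N := (LinearMap.applyₗ φ) ∘ₗ (reflexiveHullToDoubleDual N) ∘ₗ mw
    have hψ : ∀ m : N, ψ m = reflexiveHullToDoubleDual N (mw m) φ := fun _ => rfl
    -- `φ (n n') = s · ψ n'` and `s' ∣ ψ n'`
    have h1 : φ nn = s * ψ n' := by
      rw [hψ]
      refine reflexiveHullToDoubleDual_spec N (mw n') φ (s := s) (n := nn) ?_
      change algebraMap B L (b * b') = s • (w * (n' : L))
      rw [map_mul, hb, hb', hn, smul_mul_assoc]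
    obtain ⟨c, hc⟩ := dvd_apply_of_mem_reflexiveHull N hw' hn' ψ
    exact ⟨c, by rw [h1, hc, mul_assoc]⟩
  -- (c) the hull as a `B`-subalgebra of `L`, finitely generated as a module
  let H : Subalgebra B L :=
    { carrier := reflexiveHull N
      mul_mem' := fun hx hy => hmul hx hy
      one_mem' := le_reflexiveHull N (hN.mpr ⟨1, map_one _⟩)
      add_mem' := fun hx hy => Submodule.add_mem _ hx hy
      zero_mem' := Submodule.zero_mem _
      algebraMap_mem' := fun b => le_reflexiveHull N (hN.mpr ⟨b, rfl⟩) }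
  haveI : Module.Finite A N := inferInstance
  haveI hfin : Module.Finite A (reflexiveHull N) := finite_reflexiveHull (K := L) N
  obtain ⟨t, ht⟩ : (reflexiveHull N).FG := Module.Finite.iff_fg.mp hfin
  have hHfg : (Subalgebra.toSubmodule H).FG := by
    refine ⟨t, le_antisymm ?_ ?_⟩
    · rw [Submodule.span_le]
      intro x hx
      change x ∈ reflexiveHull N
      rw [← ht]
      exact Submodule.subset_span hx
    · intro x hx
      change x ∈ reflexiveHull N at hx
      rw [← ht] at hx
      exact Submodule.span_le_restrictScalars A B (t : Set L) hx
  -- (d) `hull = N` by normality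
  have hle : reflexiveHull N ≤ N := fun w hw => by
    have hint : IsIntegral B w := IsIntegral.of_mem_of_fg H hHfg w hw
    obtain ⟨b, hb⟩ := (IsIntegrallyClosed.isIntegral_iff (R := B) (K := L)).mp hint
    exact hN.mpr ⟨b, hb⟩
  -- (e) `N`, hence `B`, is reflexive
  haveI : Module.IsReflexive A N := by
    constructor
    rw [← reflexiveHullToDoubleDual_comp_inclusion N]
    exact (reflexiveHullToDoubleDual_bijective (K := L) N).comp
      ⟨Submodule.inclusion_injective _, fun w => ⟨⟨w, hle w.2⟩, rfl⟩⟩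
  exact Module.equiv (LinearEquiv.ofInjective toL hinj).symm

end Reflexive

/-! ## §2 Reflexive modules have projective dimension `≤ gldim − 2` -/

section ProjDim

variable {A : Type u} [CommRing A]

/-- The kernel of a linear map `φ : F₁ → F₀` between projective modules whose cokernel has projective
dimension `≤ n + 2` has projective dimension `≤ n` (two dimension shifts). [folklore] -/
theorem hasProjectiveDimensionLT_ker {F₁ F₀ : Type u} [AddCommGroup F₁] [Module A F₁]
    [AddCommGroup F₀] [Module A F₀] [Module.Projective A F₁] [Module.Projective A F₀]
    (φ : F₁ →ₗ[A] F₀) (n : ℕ)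
    (h : HasProjectiveDimensionLT (ModuleCat.of A (F₀ ⧸ LinearMap.range φ)) (n + 3)) :
    HasProjectiveDimensionLT (ModuleCat.of A (LinearMap.ker φ)) (n + 1) := by
  have hS₀ := LinearMap.shortExact_shortComplexKer (Submodule.mkQ_surjective (LinearMap.range φ))
  have hP₀ : HasProjectiveDimensionLT (ModuleCat.of A F₀) (n + 2) :=
    hasProjectiveDimensionLT_of_ge _ 1 (n + 2) (by omega)
  have h₁ : HasProjectiveDimensionLT (ModuleCat.of A (LinearMap.ker (LinearMap.range φ).mkQ)) (n + 2) :=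
    hS₀.hasProjectiveDimensionLT_X₁ (n + 2) hP₀ h
  have e : LinearMap.ker (LinearMap.range φ).mkQ = LinearMap.range φ := Submodule.ker_mkQ _
  let ψ : F₁ →ₗ[A] LinearMap.ker (LinearMap.range φ).mkQ :=
    (LinearEquiv.ofEq _ _ e.symm).toLinearMap ∘ₗ φ.rangeRestrict
  have hψ : Function.Surjective ψ :=
    (LinearEquiv.ofEq _ _ e.symm).surjective.comp φ.surjective_rangeRestrict
  have hS₁ := LinearMap.shortExact_shortComplexKer hψ
  have hP₁ : HasProjectiveDimensionLT (ModuleCat.of A F₁) (n + 1) :=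
    hasProjectiveDimensionLT_of_ge _ 1 (n + 1) (by omega)
  have h₀ : HasProjectiveDimensionLT (ModuleCat.of A (LinearMap.ker ψ)) (n + 1) :=
    hS₁.hasProjectiveDimensionLT_X₁ (n + 1) hP₁ h₁
  have hkψ : LinearMap.ker ψ = LinearMap.ker φ := by
    ext x
    simp only [ψ, LinearMap.mem_ker, LinearMap.coe_comp, LinearEquiv.coe_coe, Function.comp_apply,
      map_eq_zero_iff _ (LinearEquiv.injective _)]
    rw [← Subtype.coe_inj, LinearMap.codRestrict_apply]
    rfl
  exact hasProjectiveDimensionLT_of_iso (LinearEquiv.ofEq _ _ hkψ).toModuleIso (n + 1)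

variable [IsNoetherianRing A]

/-- The dual of a finite module over a noetherian ring is finite. [folklore] -/
theorem finite_dual (M : Type u) [AddCommGroup M] [Module A M] [Module.Finite A M] :
    Module.Finite A (Module.Dual A M) := by
  obtain ⟨P, _, _, _, _, f, hf⟩ := Module.exists_finite_presentation A M
  exact Module.Finite.of_injective f.dualMap (LinearMap.dualMap_injective_of_surjective hf)

/-- Over a noetherian ring with `caⁿ⁺³(A) = A` (every finite module has projective dimension
`≤ n + 2`), the DUAL `M* = Hom(M, A)` of a finite module has projective dimension `≤ n`: for a finite
presentation `Q → P → M → 0`, `M*` is the kernel of `P* → Q*`. [folklore; cf. BrunsHerzog1998 Prop. 1.4.1] -/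
theorem hasProjectiveDimensionLT_dual {n : ℕ} (hA : cohomologyAnnihilatorOfDegree A (n + 3) = ⊤)
    (M : Type u) [AddCommGroup M] [Module A M] [Module.Finite A M] :
    HasProjectiveDimensionLT (ModuleCat.of A (Module.Dual A M)) (n + 1) := by
  obtain ⟨P, _, _, _, _, f, hf⟩ := Module.exists_finite_presentation A M
  obtain ⟨Q, _, _, _, _, q, hq⟩ := Module.exists_finite_presentation A (LinearMap.ker f)
  let g : Q →ₗ[A] P := (LinearMap.ker f).subtype ∘ₗ q
  have hrange : LinearMap.range g = LinearMap.ker f := by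
    rw [LinearMap.range_comp, LinearMap.range_eq_top.mpr hq, Submodule.map_top,
      Submodule.range_subtype]
  have hker : LinearMap.ker g.dualMap = LinearMap.range f.dualMap := by
    rw [LinearMap.ker_dualMap_eq_dualAnnihilator_range, hrange,
      LinearMap.range_dualMap_eq_dualAnnihilator_ker_of_surjective f hf]
  have e : Module.Dual A M ≃ₗ[A] LinearMap.ker g.dualMap :=
    (LinearEquiv.ofInjective f.dualMap (LinearMap.dualMap_injective_of_surjective hf)).trans
      (LinearEquiv.ofEq _ _ hker.symm)
  have hcoker : HasProjectiveDimensionLT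
      (ModuleCat.of A (Module.Dual A Q ⧸ LinearMap.range g.dualMap)) (n + 3) :=
    hasProjectiveDimensionLT_of_cohomologyAnnihilatorOfDegree_eq_top hA _
  haveI := hasProjectiveDimensionLT_ker g.dualMap n hcoker
  let i : ModuleCat.of A (Module.Dual A M) ≅ ModuleCat.of A (LinearMap.ker g.dualMap) :=
    { hom := ModuleCat.ofHom e.toLinearMap
      inv := ModuleCat.ofHom e.symm.toLinearMap
      hom_inv_id := ModuleCat.hom_ext (LinearMap.ext fun x => e.symm_apply_apply x)
      inv_hom_id := ModuleCat.hom_ext (LinearMap.ext fun x => e.apply_symm_apply x) }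
  exact hasProjectiveDimensionLT_of_iso i.symm (n + 1)

/-- **Reflexive modules have projective dimension `≤ gldim − 2`**: over a noetherian ring with
`caⁿ⁺³(A) = A`, a finite REFLEXIVE module `M ≅ M**` has projective dimension `≤ n`.
[folklore; cf. BrunsHerzog1998 Prop. 1.4.1] -/
theorem hasProjectiveDimensionLT_of_isReflexive {n : ℕ}
    (hA : cohomologyAnnihilatorOfDegree A (n + 3) = ⊤)
    (M : Type u) [AddCommGroup M] [Module A M] [Module.Finite A M] [Module.IsReflexive A M] :
    HasProjectiveDimensionLT (ModuleCat.of A M) (n + 1) := by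
  haveI := finite_dual (A := A) M
  haveI := hasProjectiveDimensionLT_dual hA (Module.Dual A M)
  exact hasProjectiveDimensionLT_of_iso (Module.evalEquiv A M).symm.toModuleIso (n + 1)

end ProjDim

/-! ## §3 The W3 print `jacobianFloorNN_normal_dim3` is a theorem -/

/-- **Iyengar–Takahashi 2016, Thm 3.8 (one Kähler-different summand) for normal domains of dimension
`3` — PROVED.**  For a noetherian normal domain `B` of Krull dimension `3` and every Noether
normalisation `A → B` (`A` noetherian with `∃ n, caⁿ(A) = A`, `B` module-finite over `A`, `A → B`
injective): `Fitt₀(Ω[B⁄A]) ≤ ca⁴(B)`.  Proof: `A` is regular (`caⁿ` localises, Iyengar–Takahashi 2014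
Lemma 2.10 + Auslander–Buchsbaum–Serre) of dimension `dim B = 3`, so `ca⁴(A) = A`; `B` is a reflexive
`A`-module (`isReflexive_of_isIntegrallyClosed`), so `pd_A B ≤ 1`; `Fitt₀(Ω[B⁄A]) ≤ 𝔑(B/A)`
(Scheja–Storch) and `𝔑(B/A) ≤ ca⁴(B)` by the torsion-free / `pd ≤ 1` noether-different floor.  This
discharges the named fact `Literature.RingTheory.CohomologyAnnihilator.jacobianFloorNN_normal_dim3`
WITHOUT the derived noether different of the printed proof.
[cite: IyengarTakahashi2016, Thm 3.8 (p.8 L59–66)] -/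
theorem jacobianFloorNN_normal_dim3_holds :
    Literature.RingTheory.CohomologyAnnihilator.jacobianFloorNN_normal_dim3.{u} := by
  intro B _ _ _ hBint hdim A _ _ _ _ hinj hn
  obtain ⟨n, hn⟩ := hn
  -- `A` is a domain and `B` is torsion-free over it
  haveI : IsDomain A := Function.Injective.isDomain (algebraMap A B) hinj
  haveI : FaithfulSMul A B := (faithfulSMul_iff_algebraMap_injective A B).mpr hinj
  haveI : NoZeroSMulDivisors A B := ⟨fun {a b} h => by
    rw [Algebra.smul_def, mul_eq_zero] at h
    exact h.imp_left fun ha => hinj (by rw [ha, map_zero])⟩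
  haveI := hBint
  -- `A` is regular of dimension `3`, so `ca⁴(A) = A`
  haveI : IsRegularRing A := by
    refine isRegularRing_iff.mpr fun p _ => ?_
    refine isRegularLocalRing_of_cohomologyAnnihilatorOfDegree_eq_top (n := n) (top_le_iff.mp ?_)
    calc (⊤ : Ideal (Localization.AtPrime p))
        = (cohomologyAnnihilatorOfDegree A n).map (algebraMap A (Localization.AtPrime p)) := by
          rw [hn, Ideal.map_top]
      _ ≤ cohomologyAnnihilatorOfDegree (Localization.AtPrime p) n :=
          map_cohomologyAnnihilatorOfDegree_le_of_isLocalization p.primeCompl (Localization.AtPrime p) n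
  have hdimA : ringKrullDim A ≤ 3 := by
    rw [← Literature.AlgebraicGeometry.Resolution.ringKrullDim_eq_of_isIntegral (R := A) (S := B) hinj,
      hdim]
  have hA4 : cohomologyAnnihilatorOfDegree A 4 = ⊤ :=
    cohomologyAnnihilatorOfDegree_eq_top_of_isRegularRing A hdimA
  -- `B` is reflexive over `A`, hence of projective dimension `≤ 1`
  haveI : Module.IsReflexive A B := isReflexive_of_isIntegrallyClosed
  haveI : HasProjectiveDimensionLT (ModuleCat.of A B) 2 := hasProjectiveDimensionLT_of_isReflexive hA4 B
  let e : B ≃ₗ[A] (restrictScalarsFunctor A B).obj (ModuleCat.of B B) :=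
    { toFun := fun b => b
      invFun := fun b => b
      map_add' := fun _ _ => rfl
      map_smul' := fun a b => Algebra.smul_def a b
      left_inv := fun _ => rfl
      right_inv := fun _ => rfl }
  have hpd : HasProjectiveDimensionLT ((restrictScalarsFunctor A B).obj (ModuleCat.of B B)) 2 :=
    hasProjectiveDimensionLT_of_iso e.toModuleIso 2
  -- conclude: `Fitt₀(Ω) ≤ 𝔑(B/A) ≤ ca⁴(B)`
  exact fittingIdeal_kaehlerDifferential_le_noetherDifferent.trans
    (NoetherDifferentTorsionFree.noetherDifferent_le_cohomologyAnnihilatorOfDegree_of_hasProjectiveDimensionLT_two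
      hpd (d := 3) (by norm_num) hA4)

end Summit.ResolutionOfSingularities.ResolutionOfSingularities.Theorems.NoZeno.JacobianFloorNormal

end
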